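/-
Copyright (c) 2026 the pub-hodgecm-mathlib formalisation cell (harness21).  Prover seat hodgecm-mathlib-K2Liu-p01 (g5): Track B «K2-LIT»,
#184♮ = hLiu418 = stmt-HodgeConjecture-24832, road `K2_Liu`, socket #41, organ O41.5 ∕ Φ8 at RANK ONE: the Gindikin–Karpelevich identity assembled.
-/
import Summits.HodgeConjecture.HodgeConjecture.Theorems.K2LiuUnipDeltaConjugationModulus           -- ★ Φ8a (C): `isLocalSiegelSection_localIntertwining`
import Summits.HodgeConjecture.HodgeConjecture.Theorems.K2LiuLocalIntertwiningSphericalReduction   -- ★ (r3): `localIntertwining_eq_apply_one_mul_of_isSphericalSection`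
import Summits.HodgeConjecture.HodgeConjecture.Theorems.K2LiuLocalSiegelIwasawa                    -- ★ O41.5 (4b): `exists_isSiegelDelta_mul_mem_localInt`
import HarnessLib

/-!
# Crux `HLiu418`, road `K2_Liu`, socket #41, organ O41.5 ∕ Φ8 at RANK ONE: THE GINDIKIN–KARPELEVICH IDENTITY
# `M_v(s) φ°_s = νN(N_Δ ∩ K_v) · (1 − t)∕(1 − q_v t) · φ°′` ASSEMBLED (no hypothesis but the place data)

Cell `hodgecm-mathlib`, crux item hLiu418 = `stmt-HodgeConjecture-24832`; squad K2 ∕ K2Liu; prover K2Liu-p01 (g5).  THEOREMS ONLY (no `def`,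
no `instance`, no notation, no named-fact hypothesis, no `sorry`); lane `--supports stmt-HodgeConjecture-24832` (count-neutral helper).

THE MATHEMATICS ([Casselman1980, §3 Thm. 3.1]; [HarrisKudlaSweet1996, §6 (6.14)–(6.16)]).  At rank one (`H(F_v) ≅ U(1,1)(F_v)`), a good place (`|2|_w = |δ|_w = 1`,
`T₀`, `T₀⁻¹` integral, `χ_w` unramified), a Haar measure `νN` on `N_Δ(F_v)`, `φ` spherical in `I_v(s, χ_v)`, `φ′` spherical in `I_v(−s, χ′_v)`
(`χ′_w = (χ_{w′})⁻¹ ∘ c_w`, i.e. `χ′ = (χ ∘ c)⁻¹`) and `t = (Π_w χ_w(ι_wϖ))·(Π_w ‖ι_wϖ‖_w)^{s+½}` with `‖t‖ < q_v⁻¹`: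
**`M_v φ (h) = νN(N_Δ(F_v) ∩ K_v) · (1 − t)∕(1 − q_v t) · φ′(h)`** for every `h ∈ H(F_v)` — the three ★ organs composed:
★ `isLocalSiegelSection_localIntertwining` (Φ8a: `M_v φ ∈ I_v(−s, χ′_v)`), ★ `localIntertwining_eq_apply_one_mul_of_isSphericalSection` ((r3): spherical reduction
through the Iwasawa decomposition ★ `exists_isSiegelDelta_mul_mem_localInt`) and ★ `K2LiuUnipDeltaRankOneHaar.localIntertwining_one_eq` ((r1): the value at `1`).
The dictionary `t ↔ L_v(2s, χ⁰)∕L_v(2s+1, χ⁰)`-names of ★ O41.6 is (r2), separate.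
HONEST LABEL.  Count-neutral helper; it retires nothing by itself: `HC_CM` is proved only modulo the 7 printed citations (2 remaining named inputs:
hLiu418 = `stmt-HodgeConjecture-24832`, h413 = `stmt-HodgeConjecture-24833`) until rung 0 closes.

## References
* [Casselman1980] W. Casselman, *The unramified principal series of p-adic groups I*, Compositio Math. 40 (1980): §3 Thm. 3.1.
* [HarrisKudlaSweet1996] M. Harris, S. Kudla, W. J. Sweet, J. AMS 9 (1996): §6 (6.14)–(6.16).
-/

set_option autoImplicit false
set_option linter.dupNamespace false -- the mandated namespace repeats `HodgeConjecture.HodgeConjecture`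

noncomputable section

open NumberField IsDedekindDomain Matrix MeasureTheory
open scoped NNReal
open Literature.NumberTheory.GaloisRepresentations.IsNonarchimedeanLocalField
open Literature.NumberTheory.Automorphic Literature.NumberTheory.Automorphic.UnitaryGroup
open Literature.NumberTheory.GelbartRogawski1991.UnitaryDualPair.LocalSplitting
open Literature.NumberTheory.K2Lit.LocalSiegelDoubled
open Summit.HodgeConjecture.HodgeConjecture.Cruxes.HLiu418.K2LiuUnipDeltaConjugationModulus
open Summit.HodgeConjecture.HodgeConjecture.Cruxes.HLiu418.K2LiuLocalIntertwiningSphericalReduction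
open Summit.HodgeConjecture.HodgeConjecture.Cruxes.HLiu418.K2LiuUnipDeltaRankOneHaar
open Summit.HodgeConjecture.HodgeConjecture.Cruxes.HLiu418.K2LiuLocalSiegelIwasawa

namespace Summit.HodgeConjecture.HodgeConjecture.Cruxes.HLiu418.K2LiuGKRankOneIdentity

variable (F : Type) [Field F] [NumberField F] (E : Type) [Field E] [NumberField E] [Algebra F E]
  [Algebra.IsQuadraticExtension F E] (c : E ≃ₐ[F] E)
  {δ : E} (hcδ : c δ = -δ) (hδ : δ ≠ 0) {d : F} (hd : δ * δ = algebraMap F E d)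
  (v : HeightOneSpectrum (𝓞 F)) {T₀ : Matrix (Fin 1) (Fin 1) F} (hT₀ : T₀.IsSymm) (hT₀d : IsUnit T₀.det)
  {JD : Matrix (Fin (1 + 1)) (Fin (1 + 1)) E} (hJD : JD = (gramD F 1 T₀).map (algebraMap F E))

include hT₀d in
/-- **THE RANK-ONE GINDIKIN–KARPELEVICH IDENTITY, ASSEMBLED**: at a place with `|2|_w = |δ|_w = 1`, `T₀`, `T₀⁻¹` integral and `χ_w` unramified at every `w ∣ v`, for a
Haar measure `νN` on `N_Δ(F_v)`, `φ` spherical in `I_v(s, χ_v)`, `φ′` spherical in `I_v(−s, χ′_v)` (`χ′_w = (χ_{w′})⁻¹ ∘ c_w` for `c • w = w′`), a uniformizer `ϖ`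
of `F_v` and `t := (Π_w χ_w(ι_wϖ))·(Π_w ‖ι_wϖ‖_w)^{s+½}` with `‖t‖ < q_v⁻¹`:
`M_v φ (h) = νN(N_Δ(F_v) ∩ K_v) · (1 − t)∕(1 − q_v t) · φ′(h)` for every `h ∈ H(F_v)`.
[cite: Casselman1980, §3 Thm. 3.1] [cite: HarrisKudlaSweet1996, §6 (6.14)–(6.16)] -/
theorem localIntertwining_eq_rankOne [MeasurableSpace (v.adicCompletion F)] [BorelSpace (v.adicCompletion F)]
    [MeasurableSpace (unipDeltaLocal F E c v 1 (JD := JD))] [BorelSpace (unipDeltaLocal F E c v 1 (JD := JD))]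
    (νN : Measure (unipDeltaLocal F E c v 1 (JD := JD))) [νN.IsHaarMeasure]
    (χv χv' : ∀ w : PlacesOver E v, (w.1.adicCompletion E)ˣ →* ℂˣ)
    (hχ' : ∀ (w w' : PlacesOver E v) (h : c • w.1 = w'.1),
      χv' w = (χv w')⁻¹.comp (Units.map (galAdicCompletionMap (L := E) c h : w.1.adicCompletion E →* w'.1.adicCompletion E)))
    (s : ℂ) {φ φ' : UnitaryGroup.localPi E c (1 + 1) JD v → ℂ} (hφ : IsSphericalSection F E c hcδ hδ hd v 1 hT₀ hJD χv s φ)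
    (hφ' : IsSphericalSection F E c hcδ hδ hd v 1 hT₀ hJD χv' (-s) φ')
    (h2 : ∀ w : PlacesOver E v, ValuativeRel.valuation (w.1.adicCompletion E) (2 : w.1.adicCompletion E) = 1)
    (hT : ∀ (w : PlacesOver E v) (i j : Fin 1),
      ValuativeRel.valuation (w.1.adicCompletion E) (algebraMap E (w.1.adicCompletion E) (algebraMap F E (T₀ i j))) ≤ 1)
    (hTinv : ∀ (w : PlacesOver E v) (i j : Fin 1),
      ValuativeRel.valuation (w.1.adicCompletion E) (algebraMap E (w.1.adicCompletion E) (algebraMap F E (T₀⁻¹ i j))) ≤ 1)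
    (hδw : ∀ w : PlacesOver E v, Valued.v ((δ : E) : w.1.adicCompletion E) = 1)
    (hχ : ∀ (w : PlacesOver E v) (u : (w.1.adicCompletion E)ˣ), Valued.v (u : w.1.adicCompletion E) = 1 → χv w u = 1)
    {ϖ : v.adicCompletion F} (hϖ : Valued.v ϖ = WithZero.exp (-1 : ℤ)) (hϖ0 : ∀ w : PlacesOver E v, toPlace v w ϖ ≠ 0)
    (ht : ‖(((∏ w : PlacesOver E v, χv w (Units.mk0 (toPlace v w ϖ) (hϖ0 w))) : ℂˣ) : ℂ) *
          (((∏ w : PlacesOver E v, ‖toPlace v w ϖ‖) : ℝ) : ℂ) ^ (s + 1 / 2)‖ < (residueFieldCard (v.adicCompletion F) : ℝ)⁻¹)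
    (h : UnitaryGroup.localPi E c (1 + 1) JD v) :
    localIntertwining F E c v 1 hJD νN φ h =
      νN.real {u | (u : UnitaryGroup.localPi E c (1 + 1) JD v) ∈ UnitaryGroup.localInt E c (1 + 1) JD v} *
        ((1 - ((((∏ w : PlacesOver E v, χv w (Units.mk0 (toPlace v w ϖ) (hϖ0 w))) : ℂˣ) : ℂ) *
                (((∏ w : PlacesOver E v, ‖toPlace v w ϖ‖) : ℝ) : ℂ) ^ (s + 1 / 2))) /
          (1 - (residueFieldCard (v.adicCompletion F) : ℂ) *
            ((((∏ w : PlacesOver E v, χv w (Units.mk0 (toPlace v w ϖ) (hϖ0 w))) : ℂˣ) : ℂ) *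
                (((∏ w : PlacesOver E v, ‖toPlace v w ϖ‖) : ℝ) : ℂ) ^ (s + 1 / 2)))) * φ' h := by
  have hIw := exists_isSiegelDelta_mul_mem_localInt F E c hcδ hδ hd v 1 hT₀ hJD hT₀d h2 hT hTinv
  have hM := isLocalSiegelSection_localIntertwining F E c hcδ hδ hd v 1 hT₀ hT₀d hJD νN χv χv' hχ' s hφ.1
  rw [localIntertwining_eq_apply_one_mul_of_isSphericalSection F E c hcδ hδ hd v 1 hT₀ hJD νN hIw χv s hφ χv' (-s) hM hφ' h,
    localIntertwining_one_eq F E c hcδ hδ hd v hT₀d hJD hT₀ νN χv s hφ h2 hδw hχ hϖ hϖ0 ht]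

end Summit.HodgeConjecture.HodgeConjecture.Cruxes.HLiu418.K2LiuGKRankOneIdentity

end
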